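import Mathlib
import HarnessLib
import Summits.PneNP.PneNP.Theses.RamseyUncertifiable
import Literature.Computability.MetaComplexity.Resolution
import Literature.Computability.Complexity.Circuit
import Literature.Computability.Complexity.NegationElimination

/-!
# Sketch — crux-ideate stmt-PneNP-9816 (ResolutionUncertainty), ideator 2, round 1

First lemmas of the two idea cards, stated over existing declarations (no proofs required at
this stage; everything here is a `def … : Prop` or a definitional unfolding).

* `cliqueCNF n k adj` — the crux's inline unary block clique CNF, verbatim.
* `crux_unfold` — `ResolutionUncertainty` is literally the `cliqueCNF` statement (`Iff.rfl`).
* Card `jukna-game-monotone-interpolation`: `BipartiteInterpolation` (first lemma, provable now),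
  `CliqueShadowMonotoneLB` (the transfer target C⁺, conjectural), `NearExtremalSide`.
* Card `box-dag-self-gadget-lifting`: `HeavyBlockWidth` (first lemma, provable now),
  `DispersionToLength` (the conjectural size⇒block-width simulation over bi-dense cores).
-/

set_option linter.dupNamespace false

namespace Summit.PneNP.PneNP.Cruxes.ResolutionUncertainty

open Literature.Computability.Complexity Literature.Computability.MetaComplexity

/-- The unary block clique CNF `Clique(adj, k)` on `n` vertices, exactly as inlined in the crux
`Summit.PneNP.PneNP.Theses.RamseyUncertifiable.ResolutionUncertainty`: variables `x_{i,v} ↦ i*n+v`;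
block axioms `⋁_v x_{i,v}`; functionality `¬x_{i,u} ∨ ¬x_{i,v}` (`u<v`); edge axioms
`¬x_{i,u} ∨ ¬x_{j,v}` for `i ≠ j` and `adj u v = false` (this includes `u = v`). -/
def cliqueCNF (n k : ℕ) (adj : Fin n → Fin n → Bool) : CNF ℕ :=
  ((List.range k).map fun i => (List.finRange n).map fun v => (i * n + (v : ℕ), true)) ++
  ((List.range k).flatMap fun i => (List.finRange n).flatMap fun u => (List.finRange n).flatMap
      fun v => if u < v then [[(i * n + (u : ℕ), false), (i * n + (v : ℕ), false)]] else []) ++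
  ((List.range k).flatMap fun i => (List.range k).flatMap fun j => (List.finRange n).flatMap
      fun u => (List.finRange n).flatMap fun v =>
        if i ≠ j ∧ adj u v = false then [[(i * n + (u : ℕ), false), (j * n + (v : ℕ), false)]]
        else [])

/-- The crux, restated through `cliqueCNF`. -/
def CruxUnfolded : Prop :=
  ∃ ε : ℝ, 0 < ε ∧ ∃ n₀ : ℕ, ∀ n ≥ n₀, ∀ (G : SimpleGraph (Fin n)) [DecidableRel G.Adj],
    ∀ π₁ π₂ : List (ResLine ℕ),
      IsResRefutation (cliqueCNF n (Nat.clog 2 (n ^ 2)) fun u v => decide (G.Adj u v)) π₁ →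
      IsResRefutation (cliqueCNF n (Nat.clog 2 (n ^ 2)) fun u v => decide (Gᶜ.Adj u v)) π₂ →
      (n : ℝ) ^ (ε * Real.logb 2 n) ≤ max (π₁.length : ℝ) (π₂.length : ℝ)

/-- The route's crux decl is definitionally the `cliqueCNF` statement. -/
theorem crux_unfold :
    Summit.PneNP.PneNP.Theses.RamseyUncertifiable.ResolutionUncertainty ↔ CruxUnfolded :=
  Iff.rfl

/-! ## Card A — `jukna-game-monotone-interpolation` -/

/-- **First lemma (provable now; Krajíček–Pudlák protocol extraction, no shared variables).**
Split the blocks: Alice owns `kA` blocks ranging over `A`, Bob owns `kB` blocks ranging over `Aᶜ`.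
A resolution refutation `π` of `Clique(G, kA+kB)` yields a monotone circuit over the VERTEX
variables of size `≤ |π| + n + 2` that accepts (the indicator of) every `kA`-clique of `G` inside
`A` and rejects the indicator of `A ∩ N(y)` for every `kB`-clique `y` of `G` inside `Aᶜ`
(Alice-resolved variables ↦ `∨` gates, Bob-resolved ↦ `∧`, cross edge axiom `¬x_{i,u} ∨ ¬y_{j,w}` ↦
the input `z_u`). This is a SIZE version of Jukna's clique game (arXiv:1203.5414, Thm 2). -/
def BipartiteInterpolation : Prop :=
  ∀ (n : ℕ) (G : SimpleGraph (Fin n)) [DecidableRel G.Adj] (A : Finset (Fin n)) (kA kB : ℕ),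
    kA + kB = Nat.clog 2 (n ^ 2) →
    ∀ π : List (ResLine ℕ),
      IsResRefutation (cliqueCNF n (Nat.clog 2 (n ^ 2)) fun u v => decide (G.Adj u v)) π →
      ∃ C : Circuit (Fin n), C.IsOver monotoneBasis01 ∧ C.size ≤ π.length + n + 2 ∧
        (∀ x : Finset (Fin n), x ⊆ A → G.IsNClique kA x →
          C.eval (fun v => decide (v ∈ x)) = true) ∧
        (∀ y : Finset (Fin n), y ⊆ Aᶜ → G.IsNClique kB y →
          C.eval (fun v => decide (v ∈ A ∧ ∀ w ∈ y, G.Adj v w)) = false)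

/-- **Transfer target C⁺ (conjectural): monotone SIZE lower bound for Jukna's induced-clique
function against common-neighbourhood negatives.** For every 2-Ramsey graph one of whose sides
is near-extremal (a clique of `G` of size `≥ (1+γ)·log₂ n`; by symmetry apply to `Gᶜ` too),
some block split `(A, kA, kB)` makes every monotone separator of
`{1_x : x a kA-clique of G[A]}` from `{1_{A ∩ N(y)} : y a kB-clique of G[Aᶜ]}` have size
`≥ n^{ε log₂ n}`. Engine intended: Cavalar–Kumar–Rossman robust-sunflower approximation in the
vertex model; spreadness of both test families from Prömel–Rödl bi-density. -/
def CliqueShadowMonotoneLB : Prop :=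
  ∀ γ : ℝ, 0 < γ → ∃ ε : ℝ, 0 < ε ∧ ∃ n₀ : ℕ, ∀ n ≥ n₀,
    ∀ (G : SimpleGraph (Fin n)) [DecidableRel G.Adj],
      G.CliqueFree (Nat.clog 2 (n ^ 2)) → Gᶜ.CliqueFree (Nat.clog 2 (n ^ 2)) →
      (∃ s : Finset (Fin n), (1 + γ) * Real.logb 2 n ≤ s.card ∧ G.IsClique (s : Set (Fin n))) →
      ∃ (A : Finset (Fin n)) (kA kB : ℕ), kA + kB = Nat.clog 2 (n ^ 2) ∧
        ∀ C : Circuit (Fin n), C.IsOver monotoneBasis01 →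
          (∀ x : Finset (Fin n), x ⊆ A → G.IsNClique kA x →
            C.eval (fun v => decide (v ∈ x)) = true) →
          (∀ y : Finset (Fin n), y ⊆ Aᶜ → G.IsNClique kB y →
            C.eval (fun v => decide (v ∈ A ∧ ∀ w ∈ y, G.Adj v w)) = false) →
          (n : ℝ) ^ (ε * Real.logb 2 n) ≤ (C.size : ℝ) + n + 2

/-- The regime the card covers: one side of the Ramsey graph is `(1+γ)`-near-extremal. This holds
for a.a.s. `G(n,½)` and for EVERY graph iff no graph beats Erdős's bound `R(s,s) > 2^{s/2}` by a
factor `2/(1+γ)` in the exponent — not provable today (Erdős–Szekeres gives only `½·log₂ n`). -/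
def NearExtremalSide (γ : ℝ) (n : ℕ) (G : SimpleGraph (Fin n)) : Prop :=
  ∃ s : Finset (Fin n), (1 + γ) * Real.logb 2 n ≤ s.card ∧
    (G.IsClique (s : Set (Fin n)) ∨ Gᶜ.IsClique (s : Set (Fin n)))

/-- Composition check (logic only): the first lemma and C⁺ give the crux on the near-extremal
regime. Stated as a `Prop`; its proof is bookkeeping (`max`, symmetry `G ↔ Gᶜ`, monotonicity of
`n ↦ n^{ε log n}`), left to crux-plan. -/
def CardA_Composition : Prop :=
  BipartiteInterpolation → CliqueShadowMonotoneLB →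
    ∀ γ : ℝ, 0 < γ → ∃ ε : ℝ, 0 < ε ∧ ∃ n₀ : ℕ, ∀ n ≥ n₀,
      ∀ (G : SimpleGraph (Fin n)) [DecidableRel G.Adj], NearExtremalSide γ n G →
        ∀ π₁ π₂ : List (ResLine ℕ),
          IsResRefutation (cliqueCNF n (Nat.clog 2 (n ^ 2)) fun u v => decide (G.Adj u v)) π₁ →
          IsResRefutation (cliqueCNF n (Nat.clog 2 (n ^ 2)) fun u v => decide (Gᶜ.Adj u v)) π₂ →
          (n : ℝ) ^ (ε * Real.logb 2 n) ≤ max (π₁.length : ℝ) (π₂.length : ℝ)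

/-! ## Card B — `box-dag-self-gadget-lifting` -/

/-- Block `i` is HEAVY in the clause `D` (over `m` vertices): `D` pins block `i` by a negative
literal, or excludes at least `M` candidates of block `i` by positive literals. -/
def heavyBlocks (m k M : ℕ) (D : Finset (Literal ℕ)) : Finset ℕ :=
  (Finset.range k).filter fun i =>
    (∃ v : Fin m, (i * m + v.val, false) ∈ D) ∨
      M ≤ ((Finset.univ : Finset (Fin m)).filter fun v : Fin m => (i * m + v.val, true) ∈ D).card

/-- **First lemma of card B (provable now): heavy-block width — LPRT's Lemma 13 in UNARY.**
If `H` on `m` vertices is one-sidedly `δ`-dense at scale `M` (every two `M`-sets span density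
`≥ δ`, the Prömel–Rödl core property, arXiv:1303.3166 Lemma 11) and there is room for `t`
fixings, then EVERY resolution refutation of `Clique(H, k)` contains a clause with `≥ t` heavy
blocks. Proof: Pudlák/Atserias–Dalmau Prover–Adversary game where the Adversary privately fixes a
good vertex (dense into all current candidate sets and all common neighbourhoods of sub-cliques)
whenever a block becomes heavy; fixed blocks ⊆ heavy blocks; it survives while `< t` are fixed. -/
def HeavyBlockWidth : Prop :=
  ∀ (m k M t : ℕ) (δ : ℚ) (H : SimpleGraph (Fin m)) [DecidableRel H.Adj],
    0 < δ → 1 ≤ M →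
    (∀ A B : Finset (Fin m), M ≤ A.card → M ≤ B.card → δ ≤ H.edgeDensity A B) →
    ((k + 2 ^ t + 2) * M : ℚ) ≤ δ ^ t * m / 2 →
    ∀ π : List (ResLine ℕ),
      IsResRefutation (cliqueCNF m k fun u v => decide (H.Adj u v)) π →
      ∃ l ∈ π, t ≤ (heavyBlocks m k M l.clause).card

/-- **Conjectural half of card B (the lever): dispersion-to-length.** Over a two-sidedly
bi-dense core (Prömel–Rödl), resolution length is at least `m^{c·t}` whenever `t` fixings have
room — a size⇒block-width conversion at rate `log m` per heavy block (what Ben-Sasson–Wigderson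
cannot give here), to be proved by a GGKS/LMMPZ-style structure-vs-density simulation on
`k`-dimensional BOXES (falsifying sets of clauses on transversal tuples) with the graph's own
adjacency as the gadget and relative (fibre) min-entropy as the potential. -/
def DispersionToLength : Prop :=
  ∃ c : ℝ, 0 < c ∧ ∀ (m k M t : ℕ) (δ : ℚ) (H : SimpleGraph (Fin m)) [DecidableRel H.Adj],
    0 < δ → 1 ≤ M → 1 ≤ t →
    (∀ A B : Finset (Fin m), M ≤ A.card → M ≤ B.card →
        δ ≤ H.edgeDensity A B ∧ H.edgeDensity A B ≤ 1 - δ) →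
    ((k + 2 ^ t + 2) * M : ℚ) ≤ δ ^ t * m / 2 →
    ∀ π : List (ResLine ℕ),
      IsResRefutation (cliqueCNF m k fun u v => decide (H.Adj u v)) π →
      (m : ℝ) ^ (c * t) ≤ π.length

end Summit.PneNP.PneNP.Cruxes.ResolutionUncertainty
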